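import Summits.CriticalPhenomena.PercolationContinuityZ3.Theorems.Transplant.TriFilmSKGeo
import Summits.CriticalPhenomena.PercolationContinuityZ3.Theorems.Transplant.Slab111SK4Plan
import HarnessLib

/-!
# Triangular film `𝕋 × {0,1}`, IV: the cleared SET of a case and film PATHS from index data

builds on p205010 (kernel theorem, internal audit signed; external expert review pending) — NOT used in this file.  Lane `prim-bschramm`, seat
`prim-bschramm-p2` (gen 39; class C1b; memo `HOME/bschramm/P2-LATTICES.md` §138); helper file (`--supports stmt-CriticalPhenomena-4575 --as helper`).
«Slab111SK4Path» for the triangular films: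
* §1 **`WsetT C z`** — the cleared vertex set of the block at `z` (the film vertices of the valid bits of the mask `C.W`), membership lemmas, and the rerouting
  part `WsetT ∩ \overline{blkR 3 z t_R s_R}` read from the mask `C.WR`;
* §2 **`gpath_of_idx`** — a validated index list (`AdjRelT`-chain, no repetitions, valid) is a self-avoiding film path («VPathKit».`GPath`);
* §3 **`exists_branch_of_reach`** — a bit of `reachT u R (bitOf b)` is joined to `vtxT b` by a self-avoiding film path all of whose vertices are vertices of
  bits of `R`.
[cite: DuminilCopinSidoraviciusTassion2016, §2.3 (proof of Fact 2: the paths γ_u, γ_v, γ_w)]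
-/

noncomputable section

namespace Summit.CriticalPhenomena.PercolationContinuityZ3.Theorems.Transplant

open Literature.Probability.Percolation Literature.Probability.LatticeModels SimpleGraph
open scoped Classical

namespace TriFilm.SKT

open Slab111.SK (bitOf sdiff maskBelow maskOfList endsOK orFold rd rdMask testBit_bitOf testBit_sdiff testBit_maskBelow of_testBit_maskBelow testBit_maskBelow_of testBit_maskOfList testBit_maskOfList_eq_false endsOK_sound)

variable {C : CtxT} {z : Site 2}

/-! ## §1 The cleared set -/

/-- **The cleared vertex set of the case at the block centre `z`**: the film vertices of the valid bits of `C.W`. [folklore] -/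
def WsetT (C : CtxT) (z : Site 2) : Set (triFilm C.k) := {x | ∃ i, C.validB i = true ∧ C.W.testBit i = true ∧ vtxT C.k z i = x}

/-- Membership of an index vertex in the cleared set. [folklore] -/
theorem vtx_mem_Wset_iff {i : ℕ} (hv : C.validB i = true) : vtxT C.k z i ∈ WsetT C z ↔ C.W.testBit i = true := by
  constructor
  · rintro ⟨j, hj, hW, he⟩
    rw [vtx_inj hj hv he] at hW; exact hW
  · intro h; exact ⟨i, hv, h, rfl⟩

/-- A member of the cleared set is an index vertex. [folklore] -/
theorem exists_idx_of_mem_Wset {x : triFilm C.k} (h : x ∈ WsetT C z) : ∃ i, C.validB i = true ∧ C.W.testBit i = true ∧ vtxT C.k z i = x := h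

/-- **The rerouting mask reads `WsetT ∩ \overline{blkR 3 z t_R s_R}`.** [folklore] -/
theorem testBit_WR_iff_mem {i : ℕ} (hv : C.validB i = true) {tR sR : ℕ} (htR : C.tR = min tR 3) (hsR : C.sR = min sR 3) :
    C.WR.testBit i = true ↔ vtxT C.k z i ∈ WsetT C z ∩ (hexShadow C.k).lift (blkR 3 z tR sR) := by
  rw [testBit_WR_iff, Set.mem_inter_iff, vtx_mem_Wset_iff hv, HexShadow.mem_lift, inRB_iff_mem_blkR hv htR hsR]

/-! ## §2 Film paths from validated index lists -/

/-- **A validated index list is a self-avoiding film path.** [folklore] -/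
theorem gpath_of_idx {l : List ℕ} (hne : l ≠ []) (hv : ∀ x ∈ l, C.validB x = true) (hch : l.IsChain AdjRelT)
    (hnd : l.Nodup) : GPath (film C.k) (l.map (vtxT C.k z)) (vtxT C.k z (l.head hne)) (vtxT C.k z (l.getLast hne)) where
  ne_nil := by simpa using hne
  chain := by
    rw [List.isChain_map]
    exact hch.imp_of_mem_imp fun a b ha hb hab => adj_vtx (hv a ha) (hv b hb) hab
  nodup := hnd.map_on fun a ha b hb hab => vtx_inj (hv a ha) (hv b hb) hab
  head := by rw [List.head?_map, List.head?_eq_some_head hne]; rfl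
  last := by rw [List.getLast?_map, List.getLast?_eq_some_getLast hne]; rfl

/-- With known end points. [folklore] -/
theorem gpath_of_idx' {l : List ℕ} {s t : ℕ} (hv : ∀ x ∈ l, C.validB x = true) (hch : l.IsChain AdjRelT) (hnd : l.Nodup)
    (hs : l.head? = some s) (ht : l.getLast? = some t) : GPath (film C.k) (l.map (vtxT C.k z)) (vtxT C.k z s) (vtxT C.k z t) := by
  have hne : l ≠ [] := by rintro rfl; simp at hs
  have h1 : l.head hne = s := by rw [List.head?_eq_some_head hne, Option.some.injEq] at hs; exact hs
  have h2 : l.getLast hne = t := by rw [List.getLast?_eq_some_getLast hne, Option.some.injEq] at ht; exact ht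
  rw [← h1, ← h2]; exact gpath_of_idx hne hv hch hnd

/-- Membership read-back for mapped index lists. [folklore] -/
theorem mem_map_vtx_iff {l : List ℕ} (hv : ∀ x ∈ l, C.validB x = true) {j : ℕ} (hj : C.validB j = true) :
    vtxT C.k z j ∈ l.map (vtxT C.k z) ↔ j ∈ l := by
  rw [List.mem_map]
  constructor
  · rintro ⟨i, hi, he⟩; rw [← vtx_inj (hv i hi) hj he]; exact hi
  · intro h; exact ⟨j, h, rfl⟩

/-! ## §3 The branch from reachability -/

/-- A film walk along an index walk. [folklore] -/
theorem exists_walk_of_chain (z : Site 2) (R : ℕ) (hR : ∀ i, R.testBit i = true → C.validB i = true) :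
    ∀ (l : List ℕ) (s : ℕ), (s :: l).IsChain AdjRelT → (∀ x ∈ s :: l, R.testBit x = true) →
      ∃ p : (film C.k).Walk (vtxT C.k z s) (vtxT C.k z (walkEndT s l)), ∀ v ∈ p.support, ∃ j ∈ s :: l, vtxT C.k z j = v
  | [], s, _, _ => by
    refine ⟨Walk.nil, fun v hv => ⟨s, by simp, ?_⟩⟩
    exact (Walk.mem_support_nil_iff.mp hv).symm
  | j :: l, s, hch, hmem => by
    obtain ⟨hsj, hch'⟩ := List.isChain_cons_cons.1 hch
    obtain ⟨p, hp⟩ := exists_walk_of_chain z R hR l j hch' fun x hx => hmem x (List.mem_cons_of_mem _ hx)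
    have hadj : (film C.k).Adj (vtxT C.k z s) (vtxT C.k z j) :=
      adj_vtx (hR _ (hmem s (by simp))) (hR _ (hmem j (by simp))) hsj
    have he : walkEndT s (j :: l) = walkEndT j l := rfl
    rw [he]
    refine ⟨Walk.cons hadj p, fun v hv => ?_⟩
    rw [Walk.support_cons, List.mem_cons] at hv
    rcases hv with rfl | hv
    · exact ⟨s, by simp, rfl⟩
    · obtain ⟨i, hi, rfl⟩ := hp v hv
      exact ⟨i, List.mem_cons_of_mem _ hi, rfl⟩

/-- **THE BRANCH FROM REACHABILITY**: a bit `w` of `reachT u R (bitOf b)` (all bits of `R` valid) is joined to `vtxT b` by a self-avoiding film path whose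
vertices are vertices of bits of `R`. [cite: DuminilCopinSidoraviciusTassion2016, §2.3 (proof of Fact 2: the path γ_w)] -/
theorem exists_branch_of_reach {u R b w : ℕ} (hR : ∀ i, R.testBit i = true → C.validB i = true)
    (h : (reachT u R (bitOf b)).testBit w = true) :
    ∃ Br : List (triFilm C.k), GPath (film C.k) Br (vtxT C.k z b) (vtxT C.k z w) ∧
      ∀ x ∈ Br, ∃ j, C.validB j = true ∧ R.testBit j = true ∧ vtxT C.k z j = x := by
  obtain ⟨s, l, hs, hRs, hw, he⟩ := reachT_sound h
  rw [testBit_bitOf] at hs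
  simp only [decide_eq_true_eq] at hs
  subst hs
  obtain ⟨p, hp⟩ := exists_walk_of_chain z R hR l b hw.1 hw.2
  subst he
  have hsub := Walk.support_toPath_subset_support p
  generalize p.toPath = q at hsub
  obtain ⟨q, hqpath⟩ := q
  refine ⟨q.support, ⟨q.support_ne_nil, q.isChain_adj_support, hqpath.support_nodup, ?_, ?_⟩, ?_⟩
  · rw [List.head?_eq_some_head q.support_ne_nil, Walk.head_support]
  · rw [List.getLast?_eq_some_getLast q.support_ne_nil, Walk.getLast_support]
  · intro x hx
    obtain ⟨j, hj, rfl⟩ := hp x (hsub hx)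
    exact ⟨j, hR _ (hw.2 j hj), hw.2 j hj, rfl⟩

end TriFilm.SKT

end Summit.CriticalPhenomena.PercolationContinuityZ3.Theorems.Transplant

end
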